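import Summits.HodgeConjecture.HodgeConjecture.Theorems.Ring2AbelianAllAndreWeilFieldComponentAnchors
import Summits.HodgeConjecture.HodgeConjecture.Theorems.Ring2AbelianAllAndreWeilFieldComponentMembers
import HarnessLib

/-!
# Ring 2 · AbelianAll — ANDRÉ AXIS, PART S-g: THE δ-COMPONENT CAPSTONE — for every CM field with a nondegenerate CM type, every `E`-rank `2p` and
  EVERY discriminant class `δ`, ONE anchor `(A₀, η₀, h₀)` (ring2-b03's CM power member: Weil type, Rosati-compatible, discriminant `δ`, Hodge
  conjecture) such that EVERY compact pencil of abelian `2pe₀`-folds with a global `E`-action and a global polarization class, `E`-isogenous at one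
  chart to the anchor with matching class, STAYS ON THE δ-COMPONENT (every member of Weil type, Rosati-compatible, of discriminant `δ`) and —
  granted `B⋆` of its ONE total space — has ALL the `E`-Weil classes of EVERY member algebraic: the conclusion of the cell's typed target
  `WeilClassesComponentCM R e₀ p δ` for the members of every such pencil (∃ anchor ∀ pencils; fact-free)

HONEST FRAMING (page 1, verbatim): **research route, not a corollary; conditional on HC_CM plus one named minimal statement.** Cell line:
research route conditional on HC_CM; not a corollary; Q11.4-sentence-2 already refuted in dim ≥ 3. Nothing in this file proves a case of the
Hodge conjecture beyond what the tree proves outright (Pohlmann: powers of a realisation of a nondegenerate CM type) or of `B(X)` for a named `X`,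
and `WeilClassesComponentCM R e₀ p δ` is proved for NO component: its members off the anchored `B⋆`-pencils are untouched. `HC_CM`, `HC_AV`, the global
nodes and Verdier's binder do NOT occur. Item `Theses.RankFourFaces.CMToAbelian` (stmt-16267) stays OPEN; N104 untouched; no node is born (0 `def`,
0 `sorry`, no named fact). Seat `pub-hodge-ring2-ab-andre-2`, gen 49 (part S, closing file): part S-b (∃ anchor ∀ pencils on every δ-component:
`W_E` algebraic, Weil type) composed with part S-f (the pencil stays on the δ-component; the component data and the conclusion at every member).

## Content (theorems only; standard axioms)

* **`exists_componentAnchor_forall_pencil_componentData`** — `K` a CM field of degree `2e₀ > 2` with a NONDEGENERATE CM type, Deligne's presentation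
  `(b₀, R)`, `p ≥ 1`, ANY `δ ∈ E⁺ˣ/N(Eˣ)`: ∃ `(A₀, η₀, h₀)` — of CM type, `IsWeilTypeCM A₀ η₀ R e₀ p`, `h₀` a polarization class, Rosati-compatible,
  `HasWeilDiscriminantCM … h₀ δ`, `HodgeConjectureFor A₀`, `W_E(A₀) ⊗ ℂ ⊆ Nᵖ(A₀)` — such that for EVERY compact pencil `f : 𝒳 ⟶ S` of abelian
  `2pe₀`-folds with `B⋆(𝒳, η) ∀η`, a global endomorphism `Φ` over `S`, a global class `H ∈ H²(𝒳(ℂ); ℂ)`, `Φ`-compatible charts `(A_s, e_s, φ_s)` with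
  `R(φ_s²) = 0`, a rational global `U` on `W_E(A_t) ⊗ ℂ` at `t` with `U|X_t ≠ 0`, and at ONE chart `A_{s₀}` an `E`-isogeny pair with the anchor
  (`u ≫ η₀ = φ_{s₀} ≫ u`, `v ≫ φ_{s₀} = η₀ ≫ v`, `v ≫ u = n·𝟙`, `u ≫ v = n'·𝟙`, `dim A_{s₀} = dim A₀`) under which the restricted class is the anchor's,
  `e_{s₀}^*(H|X_{s₀}) = u^* h₀`: at EVERY member `s`, **`(A_s, φ_s, e_s^*(H|X_s))` is of Weil type relative to `E`, Rosati-compatible, of discriminant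
  `δ`, AND `W_E(A_s, φ_s) ⊗ ℂ ⊆ Nᵖ(A_s)`**.
* **`exists_componentAnchor_forall_pencil_componentData_of_isCyclic`** — every CYCLIC Galois CM field of degree `> 2`.

## Honest status

Fact-free composition; the anchor's existence is hypothesis-free given Deligne's presentation of the field and a nondegenerate type (b03's supply:
all quartic fields — the non-Galois ones by part S-b's eightfold row —, all cyclic fields, degree `2ℓ`, abelian non-`V₄`). Not transported:
positivity of the restricted class ((o158)); not constructed: the pencil, its `E`-action, the matching global class. The open input is `B⋆` of the
one total space, unchanged in strength; nothing minimal claimed; N104 untouched. EDGE LABELS: both theorems K.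
References: Deligne1982HodgeCycles (§4 (4.4), p. 30, Lemma 4.6, Remark 4.10, proof of Thm. 4.8; §5 (c) pp. 38–39); Pohlmann1968 (Thm. 1);
Schmidt1984CMArithmetik (Kap. III Satz 2.1); MoonenZarhin1998WeilClasses (§1); Andre1996Motifs (§6.3 Lemme 6.3.3, Remarque 2); Andre2026 (§4.4.4).
-/

noncomputable section

set_option linter.dupNamespace false

namespace Summit.HodgeConjecture.HodgeConjecture.Ring2.AbelianAll

open CategoryTheory AlgebraicGeometry Polynomial NumberField
open Literature.AlgebraicGeometry Literature.AlgebraicGeometry.Motives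
open Literature.AlgebraicGeometry.HodgeTheory Literature.AlgebraicGeometry.Deligne1982
open Literature.AlgebraicGeometry.Milne1999 (IsOfCMType)
open Literature.AlgebraicGeometry.Pohlmann1968 (IsNondegenerate)
open Summit.HodgeConjecture.HodgeConjecture.Ring2.Hypotheses (RosatiCompatible)
open Summit.HodgeConjecture.HodgeConjecture.Ring2.WeilCoverageCM (exists_cmMember_hodgeConjectureFor_of_exists_isNondegenerate)

variable (K : Type) [Field K] [NumberField K] [IsCMField K]

/-- **THE δ-COMPONENT CAPSTONE (∃ anchor ∀ pencils; fact-free).** `K` a CM field of degree `2e₀ > 2` admitting a NONDEGENERATE CM type, with Deligne's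
presentation (`b₀ ∈ 𝓞_K` purely imaginary separating the embeddings, `minpoly_ℤ(b₀) = R(T²)`, roots of `R` real negative), `p ≥ 1`, ANY class
`δ ∈ E⁺ˣ/N(Eˣ)`. There is a triple `(A₀, η₀, h₀)` — ring2-b03's CM power member: `A₀` of CM type, `IsWeilTypeCM A₀ η₀ R e₀ p`, `h₀` a polarization class,
Rosati-compatible, of discriminant `δ`, the Hodge conjecture for `A₀`, `W_E(A₀) ⊗ ℂ ⊆ Nᵖ(A₀)` — such that for EVERY compact pencil `f : 𝒳 ⟶ S` of abelian
`2pe₀`-folds with `B⋆(𝒳, η)` for every `η`, a global endomorphism `Φ` over `S`, a global class `H ∈ H²(𝒳(ℂ); ℂ)`, `Φ`-compatible charts `(A_s, e_s, φ_s)`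
with `R(φ_s²) = 0`, a RATIONAL global `U ∈ H^{2p}(𝒳(ℂ); ℂ)` with `e_t^*(U|X_t) ∈ W_E(A_t) ⊗ ℂ` and `U|X_t ≠ 0`, and at ONE chart `A_{s₀}` an `E`-isogeny pair
with the anchor (`u : A_{s₀} ⟶ A₀`, `v : A₀ ⟶ A_{s₀}`, `u ≫ η₀ = φ_{s₀} ≫ u`, `v ≫ φ_{s₀} = η₀ ≫ v`, `v ≫ u = n·𝟙`, `u ≫ v = n'·𝟙`, `n, n' ≥ 1`,
`dim A_{s₀} = dim A₀`) with `e_{s₀}^*(H|X_{s₀}) = u^* h₀`: **at EVERY member `s`, `(A_s, φ_s, e_s^*(H|X_s))` is of Weil type relative to `E`, Rosati-compatible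
and of discriminant `δ` — the pencil lies on the δ-component `(R, e₀, p, δ)` — AND all of `W_E(A_s, φ_s) ⊗ ℂ` is algebraic**, i.e. the conclusion of
`Ring2.Hypotheses.WeilClassesComponentCM R e₀ p δ` holds for the members of the pencil. No θ_N, no group law, no Verdier, no `HC_CM`, no Hodge–Weil
theorem in print. [cite: Deligne1982HodgeCycles, §4 (4.4), Lemma 4.6, Remark 4.10, proof of Thm. 4.8 and §5 (c) pp. 38–39] [cite: Pohlmann1968, Thm. 1]
[cite: Andre1996Motifs, §6.3 Lemme 6.3.3 and Remarque 2 (p. 33)] [cite: MoonenZarhin1998WeilClasses, §1 (dim_F W_F = 1; Criterion)] [cite: Andre2026, §4.4.4] -/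
theorem exists_componentAnchor_forall_pencil_componentData (hK : 2 < Module.finrank ℚ K)
    {b₀ : 𝓞 K} (hb₀ : IsCMField.complexConj K (b₀ : K) = -(b₀ : K))
    (hsep : Function.Injective fun σ : K →+* ℂ => σ (b₀ : K))
    {R : Polynomial ℤ} {e₀ : ℕ} (he : Module.finrank ℚ K = 2 * e₀) (hRm : R.Monic) (hRdeg : R.natDegree = e₀)
    (hR : R.comp (X ^ 2) = minpoly ℤ b₀) (hirr : Irreducible (cmPolyQ R))
    (hroots : ∀ s : ℂ, Polynomial.eval₂ (Int.castRingHom ℂ) s R = 0 → s.im = 0 ∧ s.re < 0)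
    (haev : Polynomial.aeval (b₀ : K) (cmPolyQ R) = 0) (hdegQ : (cmPolyQ R).natDegree = Module.finrank ℚ K)
    [Fact (Irreducible (realPolyQ R))] (hnd : ∃ Ψ : CMType K, IsNondegenerate Ψ) {p : ℕ} (hp : 0 < p)
    (δ : cmNormResidueGroup R) :
    ∃ (A₀ : AbelianVariety ℂ) (η₀ : A₀ ⟶ A₀) (h₀ : complexBetti A₀.X 2),
      (IsOfCMType A₀ ∧ IsWeilTypeCM A₀ η₀ R e₀ p ∧ IsPolarizationClass A₀.dim A₀.X h₀ ∧ RosatiCompatible A₀ η₀ h₀ ∧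
        HasWeilDiscriminantCM A₀ η₀ R e₀ p h₀ δ ∧ HodgeConjectureFor A₀.dim A₀.X ∧
        weilClassesField A₀ η₀ (R.comp (X ^ 2)) (2 * p) ≤ algebraicClasses A₀.X p) ∧
      ∀ {𝒳 S : SchemeOver ℂ} {f : 𝒳 ⟶ S} (_hf : IsCompactAbelianPencil f (2 * p * e₀))
        (_hB : ∀ ηX : complexBetti 𝒳 2, StandardConjectureBStar (2 * p * e₀ + 1) 𝒳 ηX)
        (Φ : 𝒳 ⟶ 𝒳) (_hΦ : Φ ≫ f = f) (H : complexBetti 𝒳 2)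
        (A : ComplexPoints S → AbelianVariety ℂ) (e : ∀ s, (A s).X ≅ fiberOver f s) (φ : ∀ s, A s ⟶ A s)
        (_hK : ∀ s, ∃ Φs : fiberOver f s ⟶ fiberOver f s,
          Φs ≫ fiberι f s = fiberι f s ≫ Φ ∧ (e s).hom ≫ Φs = (φ s).hom.hom.hom ≫ (e s).hom)
        (_hP : ∀ s, Polynomial.eval₂ (Int.castRingHom (CategoryTheory.End (A s))) ((φ s : CategoryTheory.End (A s)))
          (R.comp (X ^ 2)) = 0)
        (U : complexBetti 𝒳 (2 * p)) (_hUQ : IsRationalClass U) {t : ComplexPoints S}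
        (_hUt : complexBetti.map (e t).hom (2 * p) (complexBetti.map (fiberι f t) (2 * p) U) ∈
          weilClassesField (A t) (φ t) (R.comp (X ^ 2)) (2 * p))
        (_hU0 : complexBetti.map (fiberι f t) (2 * p) U ≠ 0)
        {s₀ : ComplexPoints S} (_hdim : (A s₀).dim = A₀.dim) (u : A s₀ ⟶ A₀) (v : A₀ ⟶ A s₀) {n n' : ℕ} (_hn : 0 < n) (_hn' : 0 < n')
        (_hvu : v ≫ u = n • 𝟙 A₀) (_huv : u ≫ v = n' • 𝟙 (A s₀)) (_hu : u ≫ η₀ = φ s₀ ≫ u) (_hv : v ≫ φ s₀ = η₀ ≫ v)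
        (_hH₀ : complexBetti.map (e s₀).hom 2 (complexBetti.map (fiberι f s₀) 2 H) = complexBetti.map u.hom.hom.hom 2 h₀)
        (s : ComplexPoints S),
        (IsWeilTypeCM (A s) (φ s) R e₀ p ∧
          RosatiCompatible (A s) (φ s) (complexBetti.map (e s).hom 2 (complexBetti.map (fiberι f s) 2 H)) ∧
          HasWeilDiscriminantCM (A s) (φ s) R e₀ p (complexBetti.map (e s).hom 2 (complexBetti.map (fiberι f s) 2 H)) δ) ∧
        weilClassesField (A s) (φ s) (R.comp (X ^ 2)) (2 * p) ≤ algebraicClasses (A s).X p := by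
  obtain ⟨A₀, η₀, h₀, hcm, hW, hpol, hros, hdisc, hHC, halg⟩ :=
    exists_cmMember_hodgeConjectureFor_of_exists_isNondegenerate K hK hb₀ hsep he hRm hRdeg hR hirr hroots haev hdegQ hnd hp δ
  refine ⟨A₀, η₀, h₀, ⟨hcm, hW, hpol, hros, hdisc, hHC, halg⟩, ?_⟩
  intro 𝒳 S f hf hB Φ hΦ H A e φ hK' hP U hUQ t hUt hU0 s₀ hdim u v n n' hn hn' hvu huv hu hv hH₀ s
  exact weilClassesField_le_algebraicClasses_and_componentData_member_of_lefschetzB hf hB Φ hΦ H A e φ hK' hP U hUQ hUt hU0 hW hros hdisc halg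
    hdim u v hn hn' hvu huv hu hv hH₀ s

/-- **Every CYCLIC Galois CM field of degree `> 2`** (a nondegenerate CM type exists — Schmidt Kap. III Satz 2.1 / Kor. 3.3 in the tree): the δ-component
capstone `exists_componentAnchor_forall_pencil_componentData` on EVERY row `(E, 2p, δ)`. [cite: Schmidt1984CMArithmetik, Kap. III Satz 2.1]
[cite: Pohlmann1968, Thm. 1] [cite: Deligne1982HodgeCycles, §5 (c) pp. 38–39] [cite: Andre1996Motifs, §6.3 Lemme 6.3.3 and Remarque 2 (p. 33)] -/
theorem exists_componentAnchor_forall_pencil_componentData_of_isCyclic [IsGalois ℚ K] (hc : IsCyclic (K ≃ₐ[ℚ] K))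
    (hK : 2 < Module.finrank ℚ K)
    {b₀ : 𝓞 K} (hb₀ : IsCMField.complexConj K (b₀ : K) = -(b₀ : K))
    (hsep : Function.Injective fun σ : K →+* ℂ => σ (b₀ : K))
    {R : Polynomial ℤ} {e₀ : ℕ} (he : Module.finrank ℚ K = 2 * e₀) (hRm : R.Monic) (hRdeg : R.natDegree = e₀)
    (hR : R.comp (X ^ 2) = minpoly ℤ b₀) (hirr : Irreducible (cmPolyQ R))
    (hroots : ∀ s : ℂ, Polynomial.eval₂ (Int.castRingHom ℂ) s R = 0 → s.im = 0 ∧ s.re < 0)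
    (haev : Polynomial.aeval (b₀ : K) (cmPolyQ R) = 0) (hdegQ : (cmPolyQ R).natDegree = Module.finrank ℚ K)
    [Fact (Irreducible (realPolyQ R))] {p : ℕ} (hp : 0 < p) (δ : cmNormResidueGroup R) :
    ∃ (A₀ : AbelianVariety ℂ) (η₀ : A₀ ⟶ A₀) (h₀ : complexBetti A₀.X 2),
      (IsOfCMType A₀ ∧ IsWeilTypeCM A₀ η₀ R e₀ p ∧ IsPolarizationClass A₀.dim A₀.X h₀ ∧ RosatiCompatible A₀ η₀ h₀ ∧
        HasWeilDiscriminantCM A₀ η₀ R e₀ p h₀ δ ∧ HodgeConjectureFor A₀.dim A₀.X ∧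
        weilClassesField A₀ η₀ (R.comp (X ^ 2)) (2 * p) ≤ algebraicClasses A₀.X p) ∧
      ∀ {𝒳 S : SchemeOver ℂ} {f : 𝒳 ⟶ S} (_hf : IsCompactAbelianPencil f (2 * p * e₀))
        (_hB : ∀ ηX : complexBetti 𝒳 2, StandardConjectureBStar (2 * p * e₀ + 1) 𝒳 ηX)
        (Φ : 𝒳 ⟶ 𝒳) (_hΦ : Φ ≫ f = f) (H : complexBetti 𝒳 2)
        (A : ComplexPoints S → AbelianVariety ℂ) (e : ∀ s, (A s).X ≅ fiberOver f s) (φ : ∀ s, A s ⟶ A s)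
        (_hK : ∀ s, ∃ Φs : fiberOver f s ⟶ fiberOver f s,
          Φs ≫ fiberι f s = fiberι f s ≫ Φ ∧ (e s).hom ≫ Φs = (φ s).hom.hom.hom ≫ (e s).hom)
        (_hP : ∀ s, Polynomial.eval₂ (Int.castRingHom (CategoryTheory.End (A s))) ((φ s : CategoryTheory.End (A s)))
          (R.comp (X ^ 2)) = 0)
        (U : complexBetti 𝒳 (2 * p)) (_hUQ : IsRationalClass U) {t : ComplexPoints S}
        (_hUt : complexBetti.map (e t).hom (2 * p) (complexBetti.map (fiberι f t) (2 * p) U) ∈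
          weilClassesField (A t) (φ t) (R.comp (X ^ 2)) (2 * p))
        (_hU0 : complexBetti.map (fiberι f t) (2 * p) U ≠ 0)
        {s₀ : ComplexPoints S} (_hdim : (A s₀).dim = A₀.dim) (u : A s₀ ⟶ A₀) (v : A₀ ⟶ A s₀) {n n' : ℕ} (_hn : 0 < n) (_hn' : 0 < n')
        (_hvu : v ≫ u = n • 𝟙 A₀) (_huv : u ≫ v = n' • 𝟙 (A s₀)) (_hu : u ≫ η₀ = φ s₀ ≫ u) (_hv : v ≫ φ s₀ = η₀ ≫ v)
        (_hH₀ : complexBetti.map (e s₀).hom 2 (complexBetti.map (fiberι f s₀) 2 H) = complexBetti.map u.hom.hom.hom 2 h₀)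
        (s : ComplexPoints S),
        (IsWeilTypeCM (A s) (φ s) R e₀ p ∧
          RosatiCompatible (A s) (φ s) (complexBetti.map (e s).hom 2 (complexBetti.map (fiberι f s) 2 H)) ∧
          HasWeilDiscriminantCM (A s) (φ s) R e₀ p (complexBetti.map (e s).hom 2 (complexBetti.map (fiberι f s) 2 H)) δ) ∧
        weilClassesField (A s) (φ s) (R.comp (X ^ 2)) (2 * p) ≤ algebraicClasses (A s).X p :=
  exists_componentAnchor_forall_pencil_componentData K hK hb₀ hsep he hRm hRdeg hR hirr hroots haev hdegQ
    (Literature.AlgebraicGeometry.Pohlmann1968.AbelianCMFieldExistence.exists_isNondegenerate_of_isCyclic hc) hp δ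

end Summit.HodgeConjecture.HodgeConjecture.Ring2.AbelianAll

end
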